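import Literature.Probability.RandomPlanarGeometry.HexParafermion
import Literature.Probability.RandomPlanarGeometry.HexSAW
import HarnessLib

/-!
# Crux `SAWDevelopingMap.ObservableToSLE` (stmt-CriticalPhenomena-10472), line
`floor-ratio-restriction-bootstrap`: the combinatorial dictionary for `stub_canonicalTransfer`

Landing target:
`Summits/CriticalPhenomena/SAWScalingLimit/Theorems/SAWDevelopingMapObservableToSLECanonicalTransferDictionary.lean`
(`--supports stmt-CriticalPhenomena-10472`).

The registered stub `stub_canonicalTransfer` moves the admissible restriction cocycle (limits of
ratios `Z_{Λ'δ}(a,b)/Z_{Λδ}(a,b)` of Duminil-Copin–Smirnov partition functions of MID-EDGE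
self-avoiding walks, `HexMidEdgeSAW`) to the canonical law `hexSAWLaw` of `HexSAW.lean` (VERTEX
self-avoiding walks of the largest mesh component `Ω_δ`, weight `x_c^{#vertices}`).  This file is
the purely combinatorial, fixed-scale part of that transfer ("discretisation glue K3(i)"):

* `embLaw_apply_toReal_eq_div`, `hexSAWLaw_apply_toReal_eq_div` — the law `P_{x,δ}` of a set of
  walks is the ratio of finite sums `(Σ_{γ ∈ S} x^{ℓ(γ)}) / (Σ_γ x^{ℓ(γ)})`;
* `exists_equiv_isPath_hexMidEdgeSAW` — for distinct boundary mid-edges `s_a = {v_a,u_a}`,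
  `s_b = {v_b,u_b}` of `Λ` the mid-edge walks `s_a → s_b` in `Λ` are in verts-preserving bijection
  with the self-avoiding vertex paths `v_a → v_b` of `ℍ` inside `Λ` (`ℓ(γ) = #vertices`);
* `exists_equiv_isPath_of_le`, `exists_equiv_embDomainSAW_isPath` — walks of `Ω_δ` versus
  honeycomb paths inside a vertex set on which `Ω_δ` has all honeycomb edges;
* `sum_ite_subset_eq_sum` — exact lattice restriction as an IDENTITY:
  `Σ_{γ ⊂ Λ : γ ⊆ Λ'} f(γ) = Σ_{γ ⊂ Λ'} f(γ)` for `Λ' ⊆ Λ`;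
* `hexSAWLaw_meshEvent_toReal_eq_div` = registered sub-goal `stub_canonicalTransfer_fixedScale`:
  when `Λ` carries `Ω_δ` and `Λ' = Λ ∩ Ω'_δ` has no bad edge, the `hexSAWLaw`-probability of the
  event of `stub_canonicalTransfer` ("the walk stays in the `Ω'`-mesh") is EXACTLY `Z_{Λ'}/Z_Λ`.
-/

noncomputable section

open scoped BigOperators Classical ENNReal
open MeasureTheory
open Literature.Probability.LatticeModels (HexVertex hexGraph hexCenter)
open Literature.Probability.RandomPlanarGeometry
open Literature.Probability.RandomPlanarGeometry.SAW

namespace Summit.CriticalPhenomena.SAWScalingLimit.Theorems.ObservableToSLE.FloorRatio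

/-! ### The law `P_{x,δ}` as a ratio of finite sums -/

section LawAsRatio

variable {V : Type*} {G : SimpleGraph V} {emb : V → ℂ} {Ω : Set ℂ} {δ : ℝ} {a b : V}

/-- With finitely many self-avoiding walks, the weight of a set of walks is the finite sum of the
weights `x^{ℓ(γ)}` of its members. [cite: DuminilCopinSmirnov2012, §4 (before Conjecture 1)] -/
theorem embWeight_apply_eq_sum [Fintype (EmbDomainSAW G emb Ω δ a b)] (x : ℝ)
    (S : Set (EmbDomainSAW G emb Ω δ a b)) :
    embWeight G emb Ω δ x a b S =
      ∑ γ ∈ Finset.univ.filter (· ∈ S), ENNReal.ofReal (x ^ γ.vertexCount) := by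
  rw [embWeight, Measure.sum_apply _ MeasurableSpace.measurableSet_top, tsum_fintype,
    Finset.sum_filter]
  refine Finset.sum_congr rfl fun γ _ => ?_
  rw [Measure.smul_apply, smul_eq_mul, Measure.dirac_apply' _ MeasurableSpace.measurableSet_top,
    Set.indicator_apply]
  split_ifs <;> simp

/-- **The law `P_{x,δ}` as a ratio.**  With finitely many self-avoiding walks and `x ≥ 0`, the
`P_{x,δ}`-probability of a set `S` of walks is `(Σ_{γ ∈ S} x^{ℓ(γ)}) / (Σ_γ x^{ℓ(γ)})` (both sides
are `0` in the junk case of no walk). [cite: DuminilCopinSmirnov2012, §4 (before Conjecture 1)] -/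
theorem embLaw_apply_toReal_eq_div [Fintype (EmbDomainSAW G emb Ω δ a b)] {x : ℝ} (hx : 0 ≤ x)
    (S : Set (EmbDomainSAW G emb Ω δ a b)) :
    (embLaw G emb Ω δ x a b S).toReal =
      (∑ γ ∈ Finset.univ.filter (· ∈ S), x ^ γ.vertexCount) /
        ∑ γ : EmbDomainSAW G emb Ω δ a b, x ^ γ.vertexCount := by
  rw [embLaw, Measure.smul_apply, smul_eq_mul, ENNReal.toReal_mul, ENNReal.toReal_inv,
    embWeight_apply_eq_sum, embWeight_apply_eq_sum, inv_mul_eq_div,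
    ENNReal.toReal_sum (fun _ _ => ENNReal.ofReal_ne_top),
    ENNReal.toReal_sum (fun _ _ => ENNReal.ofReal_ne_top)]
  simp only [ENNReal.toReal_ofReal (pow_nonneg hx _), Set.mem_univ, Finset.filter_true]

/-- The hexagonal case: the `hexSAWLaw`-probability of a set of walks of a bounded domain is the
ratio of critical masses `(Σ_{γ ∈ S} x_c^{ℓ(γ)}) / (Σ_γ x_c^{ℓ(γ)})`.
[cite: DuminilCopinSmirnov2012, §4 (before Conjecture 1)] -/
theorem hexSAWLaw_apply_toReal_eq_div {Ω : Set ℂ} {δ : ℝ} {a b : HexVertex}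
    [Fintype (HexDomainSAW Ω δ a b)] (S : Set (HexDomainSAW Ω δ a b)) :
    (hexSAWLaw Ω δ a b S).toReal =
      (∑ γ ∈ Finset.univ.filter (· ∈ S), hexCriticalFugacity ^ γ.vertexCount) /
        ∑ γ : HexDomainSAW Ω δ a b, hexCriticalFugacity ^ γ.vertexCount :=
  embLaw_apply_toReal_eq_div hexCriticalFugacity_pos_lt_one.1.le S

end LawAsRatio

/-! ### Mid-edge walks of a vertex domain `Λ` versus vertex paths inside `Λ` -/

section MidEdge

variable {Λ : Finset HexVertex} {va ua vb ub : HexVertex}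

/-- A vertex of a boundary mid-edge `{v, u}` (`v ∈ Λ`, `u ∉ Λ`) lying in `Λ` is `v`. [folklore] -/
private theorem eq_of_mem_sym2_of_mem {v u w : HexVertex} (hu : u ∉ Λ) (hw : w ∈ Λ)
    (h : w ∈ s(v, u)) : w = v := by
  rcases Sym2.mem_iff.1 h with rfl | rfl
  · rfl
  · exact absurd hw hu

/-- **Mid-edge walks = vertex paths (the dictionary).**  Let `s_a = {v_a, u_a}` and
`s_b = {v_b, u_b}` be two distinct boundary mid-edges of the vertex domain `Λ` (`v_a, v_b ∈ Λ`,
`u_a, u_b ∉ Λ`).  Then the self-avoiding walks `γ ⊂ Ω(Λ) : s_a → s_b` between mid-edges of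
Duminil-Copin–Smirnov are in bijection with the self-avoiding vertex paths of `ℍ` from `v_a` to
`v_b` staying inside `Λ`, the bijection sending a path to the mid-edge walk with the same list of
visited vertices (so `ℓ(γ)` = the number of vertices of the path).
[cite: DuminilCopinSmirnov2012, §1–§2 (walks between mid-edges)] -/
theorem exists_equiv_isPath_hexMidEdgeSAW (hva : va ∈ Λ) (hua : ua ∉ Λ) (hub : ub ∉ Λ)
    (ha : hexGraph.Adj va ua) (hne : s(va, ua) ≠ s(vb, ub)) :
    ∃ e : {p : hexGraph.Walk va vb // p.IsPath ∧ ∀ w ∈ p.support, w ∈ Λ} ≃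
        HexMidEdgeSAW Λ s(va, ua) s(vb, ub), ∀ p, (e p).verts = p.1.support := by
  -- the forward map: a path is the mid-edge walk with the same vertex list
  let F : {p : hexGraph.Walk va vb // p.IsPath ∧ ∀ w ∈ p.support, w ∈ Λ} →
      HexMidEdgeSAW Λ s(va, ua) s(vb, ub) := fun p =>
    { verts := p.1.support
      subset := p.2.2
      nodup := p.2.1.support_nodup
      isChain := p.1.isChain_adj_support
      head_mem := fun v hv => by
        rw [List.head?_eq_some_iff] at hv
        obtain ⟨l, hl⟩ := hv
        have : p.1.support.head p.1.support_ne_nil = v := by simp [hl]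
        rw [SimpleGraph.Walk.head_support] at this
        exact this ▸ Sym2.mem_mk_left _ _
      getLast_mem := fun v hv => by
        rw [List.getLast?_eq_some_getLast p.1.support_ne_nil, Option.some_inj,
          SimpleGraph.Walk.getLast_support] at hv
        exact hv ▸ Sym2.mem_mk_left _ _
      eq_of_nil := fun h => absurd h p.1.support_ne_nil
      edges_nodup := fun _ => by
        rw [← SimpleGraph.Walk.edges_eq_zipWith_support, List.cons_append, List.nodup_cons,
          List.mem_append, List.mem_singleton, not_or]
        refine ⟨⟨fun h => hua (p.2.2 _ (p.1.snd_mem_support_of_mem_edges h)), hne⟩, ?_⟩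
        rw [List.nodup_append]
        refine ⟨p.2.1.isTrail.edges_nodup, List.nodup_singleton _, ?_⟩
        rintro e he _ h rfl
        rw [List.mem_singleton] at h
        subst h
        exact hub (p.2.2 _ (p.1.snd_mem_support_of_mem_edges he))
      fst_mem := ⟨(SimpleGraph.mem_edgeSet hexGraph).2 ha, va, Sym2.mem_mk_left _ _, hva⟩ }
  have hF : ∀ p, (F p).verts = p.1.support := fun _ => rfl
  have hinj : Function.Injective F := fun p q h =>
    Subtype.ext (SimpleGraph.Walk.ext_support (by rw [← hF, ← hF, h]))
  have hsurj : Function.Surjective F := by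
    intro γ
    have hne' : γ.verts ≠ [] := fun h => hne (γ.eq_of_nil h)
    have hhead : γ.verts.head hne' = va :=
      eq_of_mem_sym2_of_mem hua (γ.subset _ (List.head_mem hne'))
        (γ.head_mem _ (List.head?_eq_some_head hne'))
    have hlast : γ.verts.getLast hne' = vb :=
      eq_of_mem_sym2_of_mem hub (γ.subset _ (List.getLast_mem hne'))
        (γ.getLast_mem _ (List.getLast?_eq_some_getLast hne'))
    let p : hexGraph.Walk va vb :=
      (SimpleGraph.Walk.ofSupport γ.verts hne' γ.isChain).copy hhead hlast
    have hp : p.support = γ.verts := by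
      simp only [p, SimpleGraph.Walk.support_copy, SimpleGraph.Walk.support_ofSupport]
    refine ⟨⟨p, (SimpleGraph.Walk.isPath_def p).2 (hp ▸ γ.nodup), fun w hw => γ.subset w (hp ▸ hw)⟩,
      HexMidEdgeSAW.ext ?_⟩
    rw [hF, hp]
  exact ⟨Equiv.ofBijective F ⟨hinj, hsurj⟩, fun p => hF p⟩

end MidEdge

/-! ### Walks of a subgraph that agrees with the ambient graph on `Λ` -/

section Subgraph

variable {V : Type*} {G G' : SimpleGraph V}

/-- **Subgraph dictionary.**  If `G' ≤ G` and `G'` has ALL the edges of `G` between vertices of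
`Λ`, then the self-avoiding paths of `G'` inside `Λ` are exactly the self-avoiding paths of `G`
inside `Λ` (same vertex lists).  Used with `G = ℍ`, `G' = Ω_δ` (`hexDomainGraph`) and `Λ` a
vertex set on which every honeycomb edge is an edge of `Ω_δ` (e.g. near flat boundary pieces, or
for convex `Ω`). [folklore] -/
theorem exists_equiv_isPath_of_le (hle : G' ≤ G) {Λ : Set V}
    (hΛ : ∀ v ∈ Λ, ∀ w ∈ Λ, G.Adj v w → G'.Adj v w) (u v : V) :
    ∃ e : {p : G'.Walk u v // p.IsPath ∧ ∀ w ∈ p.support, w ∈ Λ} ≃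
        {p : G.Walk u v // p.IsPath ∧ ∀ w ∈ p.support, w ∈ Λ},
      ∀ p, (e p).1.support = p.1.support := by
  have hedges : ∀ p : {p : G.Walk u v // p.IsPath ∧ ∀ w ∈ p.support, w ∈ Λ},
      ∀ e ∈ p.1.edges, e ∈ G'.edgeSet := by
    rintro p e he
    induction e using Sym2.ind with
    | h x y =>
      exact hΛ x (p.2.2 _ (p.1.fst_mem_support_of_mem_edges he)) y
        (p.2.2 _ (p.1.snd_mem_support_of_mem_edges he)) (p.1.adj_of_mem_edges he)
  refine ⟨{ toFun := fun p => ⟨p.1.mapLe hle, (SimpleGraph.Walk.isPath_mapLe hle).2 p.2.1,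
              fun w hw => p.2.2 w ?_⟩
            invFun := fun p => ⟨p.1.transfer G' (hedges p), p.2.1.transfer _,
              fun w hw => p.2.2 w ?_⟩
            left_inv := fun p => Subtype.ext (SimpleGraph.Walk.ext_support ?_)
            right_inv := fun p => Subtype.ext (SimpleGraph.Walk.ext_support ?_) },
    fun p => SimpleGraph.Walk.support_mapLe_eq_support hle p.1⟩
  · rwa [SimpleGraph.Walk.support_mapLe_eq_support] at hw
  · rwa [SimpleGraph.Walk.support_transfer] at hw
  · rw [SimpleGraph.Walk.support_transfer, SimpleGraph.Walk.support_mapLe_eq_support]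
  · rw [SimpleGraph.Walk.support_mapLe_eq_support, SimpleGraph.Walk.support_transfer]

/-- **Walks of `Ω_δ` live on the non-isolated vertices.**  If every vertex of `G'` carrying an
edge lies in `Λ` and `a ∈ Λ`, the self-avoiding walks of `G'` from `a` are exactly its
self-avoiding walks inside `Λ`; for `G' = Ω_δ = embDomainGraph …` this says that a SAW of the
discrete domain only visits vertices of the largest component(s) `embMeshDomain`. [folklore] -/
theorem exists_equiv_embDomainSAW_isPath {emb : V → ℂ} {Ω : Set ℂ} {δ : ℝ} {Λ : Set V} {a : V}
    (hΛ : ∀ v w, (embDomainGraph G emb Ω δ).Adj v w → v ∈ Λ) (ha : a ∈ Λ) (b : V) :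
    ∃ e : EmbDomainSAW G emb Ω δ a b ≃
        {p : (embDomainGraph G emb Ω δ).Walk a b // p.IsPath ∧ ∀ w ∈ p.support, w ∈ Λ},
      ∀ γ, (e γ).1 = γ.walk := by
  have hsupp : ∀ γ : EmbDomainSAW G emb Ω δ a b, ∀ w ∈ γ.walk.support, w ∈ Λ := by
    intro γ w hw
    rw [← γ.walk.cons_tail_support, List.mem_cons] at hw
    rcases hw with rfl | hw
    · exact ha
    · rw [← SimpleGraph.Walk.map_snd_darts] at hw
      obtain ⟨d, -, rfl⟩ := List.mem_map.1 hw
      exact hΛ _ _ d.adj.symm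
  exact ⟨{ toFun := fun γ => ⟨γ.walk, γ.isPath, hsupp γ⟩
           invFun := fun p => ⟨p.1, p.2.1⟩
           left_inv := fun γ => rfl
           right_inv := fun p => rfl }, fun γ => rfl⟩

/-- The vertices carrying an edge of `Ω_δ` lie in the discrete domain `embMeshDomain` (so
`exists_equiv_embDomainSAW_isPath` applies with `Λ = embMeshDomain`, or with any vertex set
containing it). [folklore] -/
theorem mem_embMeshDomain_of_adj {emb : V → ℂ} {Ω : Set ℂ} {δ : ℝ} {v w : V}
    (h : (embDomainGraph G emb Ω δ).Adj v w) : v ∈ embMeshDomain G emb Ω δ :=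
  ((embDomainGraph_adj_iff G emb).1 h).2.1

end Subgraph


/-! ### Exact restriction as an identity -/

section Restriction

variable {Λ Λ' : Finset HexVertex} {sa sb : Sym2 HexVertex}

/-- **Exact lattice restriction (identity form).**  For `Λ' ⊆ Λ` and distinct mid-edges
`s_a ≠ s_b`, summing a function of the vertex list over the walks `s_a → s_b` in `Λ` THAT STAY
IN `Λ'` gives the sum over the walks `s_a → s_b` in `Λ'`: the walks of the smaller domain are
exactly the walks of the larger one avoiding `Λ ∖ Λ'`.  With `f = x_c^{|·|}` this is
`Z_{Λ'}(s_a,s_b) = Σ_{γ ⊂ Λ, γ ⊆ Λ'} x_c^{ℓ(γ)}`, i.e. `P_Λ(γ ⊆ Λ') = Z_{Λ'}/Z_Λ`.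
[cite: LawlerSchrammWerner2004SAW, §3.4 ("SAW satisfies restriction")] -/
theorem sum_ite_subset_eq_sum {M : Type*} [AddCommMonoid M] (h : Λ' ⊆ Λ) (hne : sa ≠ sb)
    (f : List HexVertex → M) :
    (∑ γ : HexMidEdgeSAW Λ sa sb, if ∀ v ∈ γ.verts, v ∈ Λ' then f γ.verts else 0) =
      ∑ γ : HexMidEdgeSAW Λ' sa sb, f γ.verts := by
  -- the inclusion `ι : SAW(Λ') → SAW(Λ)` and its image
  let ι : HexMidEdgeSAW Λ' sa sb → HexMidEdgeSAW Λ sa sb := fun γ =>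
    ⟨γ.verts, fun v hv => h (γ.subset v hv), γ.nodup, γ.isChain, γ.head_mem, γ.getLast_mem,
      γ.eq_of_nil, γ.edges_nodup, ⟨γ.fst_mem.1, γ.fst_mem.2.imp fun v hv => ⟨hv.1, h hv.2⟩⟩⟩
  have hι : ∀ γ, (ι γ).verts = γ.verts := fun _ => rfl
  have hinj : Function.Injective ι := fun γ₁ γ₂ hγ =>
    HexMidEdgeSAW.ext (by rw [← hι, ← hι, hγ])
  have himage : (Finset.univ.filter fun γ : HexMidEdgeSAW Λ sa sb => ∀ v ∈ γ.verts, v ∈ Λ') =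
      Finset.univ.map ⟨ι, hinj⟩ := by
    ext γ
    simp only [Finset.mem_filter, Finset.mem_univ, true_and, Finset.mem_map,
      Function.Embedding.coeFn_mk]
    constructor
    · intro hγ
      have hne' : γ.verts ≠ [] := fun h0 => hne (γ.eq_of_nil h0)
      exact ⟨⟨γ.verts, hγ, γ.nodup, γ.isChain, γ.head_mem, γ.getLast_mem, γ.eq_of_nil,
        γ.edges_nodup, ⟨γ.fst_mem.1, _, γ.head_mem _ (List.head?_eq_some_head hne'),
          hγ _ (List.head_mem hne')⟩⟩, HexMidEdgeSAW.ext rfl⟩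
    · rintro ⟨γ', rfl⟩
      exact fun v hv => γ'.subset v hv
  rw [← Finset.sum_filter, himage, Finset.sum_map]
  rfl

/-- The critical-mass case: `Σ_{γ ⊂ Λ : s_a → s_b, γ ⊆ Λ'} x^{ℓ(γ)} = Z_{Λ'}(s_a, s_b)`.
[cite: LawlerSchrammWerner2004SAW, §3.4 ("SAW satisfies restriction")] -/
theorem sum_ite_subset_pow_length_eq (h : Λ' ⊆ Λ) (hne : sa ≠ sb) (x : ℝ) :
    (∑ γ : HexMidEdgeSAW Λ sa sb, if ∀ v ∈ γ.verts, v ∈ Λ' then x ^ γ.length else 0) =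
      ∑ γ : HexMidEdgeSAW Λ' sa sb, x ^ γ.length :=
  sum_ite_subset_eq_sum h hne fun l => x ^ l.length

end Restriction

/-! ### Registered form: the fixed-scale dictionary (sub-goal of `stub_canonicalTransfer`) -/

section FixedScale

variable {Ω Ω' : Set ℂ} {δ : ℝ} {Λ Λ' : Finset HexVertex} {a b ua ub : HexVertex}

/-- **The fixed-scale dictionary** (named-hypotheses form of the registered sub-goal
`stub_canonicalTransfer_fixedScale` below).  Let `Λ` be a finite vertex set carrying the discrete
domain `Ω_δ` in the sense that (i) every vertex with an edge of `Ω_δ` lies in `Λ` and (ii) every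
honeycomb edge between vertices of `Λ` is an edge of `Ω_δ`; let `Λ' = Λ ∩ {δ c_v ∈ Ω'}` be such
that every honeycomb edge inside `Λ'` is an `Ω'`-mesh edge; let `s_a = {a, u_a} ≠ s_b = {b, u_b}`
with `a ∈ Λ`, `u_a, u_b ∉ Λ` be the boundary mid-edges below the endpoints.  Then the
`hexSAWLaw Ω δ a b`-probability that the walk stays in the `Ω'`-mesh (all vertices in `Ω'`, all
steps `Ω'`-mesh edges — the event of `stub_canonicalTransfer`) is EXACTLY
`Z_{Λ'}(s_a,s_b) / Z_Λ(s_a,s_b)`, `Z_Λ(s,t) = Σ_{γ ⊂ Λ : s → t} x_c^{ℓ(γ)}`.  (Composite of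
`exists_equiv_embDomainSAW_isPath`, `exists_equiv_isPath_of_le`,
`exists_equiv_isPath_hexMidEdgeSAW`, `hexSAWLaw_apply_toReal_eq_div` and the exact restriction
identity `sum_ite_subset_pow_length_eq`.) [cite: DuminilCopinSmirnov2012, §4 (before Conjecture 1)] -/
theorem hexSAWLaw_meshEvent_toReal_eq_div
    (hΛ : ∀ v ∈ Λ, ∀ w ∈ Λ, hexGraph.Adj v w → (hexDomainGraph Ω δ).Adj v w)
    (hΛdom : ∀ v w, (hexDomainGraph Ω δ).Adj v w → v ∈ Λ)
    (hΛ' : ∀ v, v ∈ Λ' ↔ v ∈ Λ ∧ v ∈ embMeshVertices hexCenter Ω' δ)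
    (hΛ'e : ∀ v ∈ Λ', ∀ w ∈ Λ', hexGraph.Adj v w →
      (embMeshGraph hexGraph hexCenter Ω' δ).Adj v w)
    (ha : a ∈ Λ) (hua : ua ∉ Λ) (hub : ub ∉ Λ) (hadj : hexGraph.Adj a ua)
    (hne : s(a, ua) ≠ s(b, ub)) :
    ((hexSAWLaw Ω δ a b)
      {γ | (∀ v ∈ γ.walk.support, v ∈ embMeshVertices hexCenter Ω' δ) ∧
        ∀ e ∈ γ.walk.darts, (embMeshGraph hexGraph hexCenter Ω' δ).Adj e.fst e.snd}).toReal =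
      (∑ γ : HexMidEdgeSAW Λ' s(a, ua) s(b, ub), hexCriticalFugacity ^ γ.length) /
        ∑ γ : HexMidEdgeSAW Λ s(a, ua) s(b, ub), hexCriticalFugacity ^ γ.length := by
  -- the composite bijection `HexDomainSAW Ω δ a b ≃ HexMidEdgeSAW Λ s_a s_b`, `verts = support`
  obtain ⟨e₁, he₁⟩ := exists_equiv_embDomainSAW_isPath (G := hexGraph) (emb := hexCenter)
    (Ω := Ω) (δ := δ) (Λ := (↑Λ : Set HexVertex)) (fun v w h => hΛdom v w h) ha b
  obtain ⟨e₂, he₂⟩ := exists_equiv_isPath_of_le (embDomainGraph_le hexGraph hexCenter Ω δ)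
    (Λ := (↑Λ : Set HexVertex)) (fun v hv w hw h => hΛ v hv w hw h) a b
  obtain ⟨e₃, he₃⟩ := exists_equiv_isPath_hexMidEdgeSAW (vb := b) ha hua hub hadj hne
  set E : HexDomainSAW Ω δ a b ≃ HexMidEdgeSAW Λ s(a, ua) s(b, ub) := (e₁.trans e₂).trans e₃
    with hEdef
  have hE : ∀ γ, (E γ).verts = γ.walk.support := fun γ => by
    rw [hEdef, Equiv.trans_apply, Equiv.trans_apply, he₃, he₂, he₁]
  have hElen : ∀ γ, (E γ).length = γ.vertexCount := fun γ => by
    rw [HexMidEdgeSAW.length, hE, SimpleGraph.Walk.length_support]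
    rfl
  -- every walk stays in `Λ`
  have hsuppΛ : ∀ (γ : HexDomainSAW Ω δ a b), ∀ v ∈ γ.walk.support, v ∈ Λ := fun γ v hv => by
    have h := (e₁ γ).2.2 v
    rw [he₁] at h
    exact h hv
  -- the event is `support ⊆ Λ'`
  have hevent : ∀ γ : HexDomainSAW Ω δ a b,
      ((∀ v ∈ γ.walk.support, v ∈ embMeshVertices hexCenter Ω' δ) ∧
        ∀ e ∈ γ.walk.darts, (embMeshGraph hexGraph hexCenter Ω' δ).Adj e.fst e.snd) ↔
      ∀ v ∈ (E γ).verts, v ∈ Λ' := by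
    intro γ
    rw [hE]
    constructor
    · rintro ⟨hv, -⟩ v hvs
      exact (hΛ' v).2 ⟨hsuppΛ γ v hvs, hv v hvs⟩
    · intro h
      refine ⟨fun v hv => ((hΛ' v).1 (h v hv)).2, fun e he => ?_⟩
      exact hΛ'e _ (h _ (γ.walk.dart_fst_mem_support_of_mem_darts he)) _
        (h _ (γ.walk.dart_snd_mem_support_of_mem_darts he))
        (embDomainGraph_le hexGraph hexCenter Ω δ e.adj)
  haveI : Fintype (HexDomainSAW Ω δ a b) := Fintype.ofEquiv _ E.symm
  have hsub : Λ' ⊆ Λ := fun v hv => ((hΛ' v).1 hv).1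
  rw [hexSAWLaw_apply_toReal_eq_div, Finset.sum_filter,
    ← sum_ite_subset_pow_length_eq hsub hne, ← E.sum_comp, ← E.sum_comp]
  congr 1
  · refine Finset.sum_congr rfl fun γ _ => ?_
    rw [hElen]
    by_cases h : ∀ v ∈ (E γ).verts, v ∈ Λ'
    · rw [if_pos h, if_pos]
      exact (hevent γ).2 h
    · rw [if_neg h, if_neg]
      exact fun h' => h ((hevent γ).1 h')
  · exact Finset.sum_congr rfl fun γ _ => by rw [hElen]

/-- **Registered sub-goal `stub_canonicalTransfer_fixedScale`** (crux item
stmt-CriticalPhenomena-10472, line `floor-ratio-restriction-bootstrap`, stub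
`stub_canonicalTransfer`): THE FIXED-SCALE DICTIONARY between the canonical law `hexSAWLaw` of
`HexSAW.lean` and ratios of Duminil-Copin–Smirnov partition functions of mid-edge walks, in
registry form (see `hexSAWLaw_meshEvent_toReal_eq_div`). [cite: DuminilCopinSmirnov2012, §4 (before Conjecture 1)] -/
theorem stub_canonicalTransfer_fixedScale :
    ∀ (Ω Ω' : Set ℂ) (δ : ℝ) (Λ Λ' : Finset HexVertex) (a b ua ub : HexVertex),
    (∀ v ∈ Λ, ∀ w ∈ Λ, hexGraph.Adj v w → (hexDomainGraph Ω δ).Adj v w) →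
    (∀ v w : HexVertex, (hexDomainGraph Ω δ).Adj v w → v ∈ Λ) →
    (∀ v : HexVertex, v ∈ Λ' ↔ v ∈ Λ ∧ v ∈ embMeshVertices hexCenter Ω' δ) →
    (∀ v ∈ Λ', ∀ w ∈ Λ', hexGraph.Adj v w → (embMeshGraph hexGraph hexCenter Ω' δ).Adj v w) →
    a ∈ Λ → ua ∉ Λ → ub ∉ Λ → hexGraph.Adj a ua → s(a, ua) ≠ s(b, ub) →
    ((hexSAWLaw Ω δ a b)
      {γ | (∀ v ∈ γ.walk.support, v ∈ embMeshVertices hexCenter Ω' δ) ∧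
        ∀ e ∈ γ.walk.darts, (embMeshGraph hexGraph hexCenter Ω' δ).Adj e.fst e.snd}).toReal =
      (∑ γ : HexMidEdgeSAW Λ' s(a, ua) s(b, ub), hexCriticalFugacity ^ γ.length) /
        ∑ γ : HexMidEdgeSAW Λ s(a, ua) s(b, ub), hexCriticalFugacity ^ γ.length :=
  fun _ _ _ _ _ _ _ _ _ hΛ hΛdom hΛ' hΛ'e ha hua hub hadj hne =>
    hexSAWLaw_meshEvent_toReal_eq_div hΛ hΛdom hΛ' hΛ'e ha hua hub hadj hne

end FixedScale

end Summit.CriticalPhenomena.SAWScalingLimit.Theorems.ObservableToSLE.FloorRatio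

end
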